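import Summits.Ventures.CertifiedManyBodySolver.Theorems.R2cStripCellTTPrimeConsumer
import HarnessLib

/-!
# Route `R2cOpenStripTangentLine` — the `t′`-GENERAL strip-cell consumer, part 2/2: ROW-MAKERS and the CLAIM-NODE
# PACKAGING `energyDensityTT'_le_of_exists_stripCellCertTT'`

HONEST FRAMING: first certified bounds; not a superconductivity verdict; every number certified or labelled float.
NO NUMBER IS CLAIMED HERE: every theorem is an implication from the data a strip-cell certificate asserts
(`proof.conditional` by design). Nothing here asserts that such a certificate exists.

Venture `Ventures/CertifiedManyBodySolver` (sr-mbsolver), the `t′`-general strip-cell transport theorem (VAR r211 item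
V13), PART 5b — the last part. Today `Theorems.energyDensityTT'_le_of_exists_stripCellCert₂`
(`Theorems/R2cStripCellSpinSectors.lean`) types eng-1's `bd-strip-cell-v1` certificates at `t′ = 0` only; bare `t′ ≠ 0`
strip cells (the t′-ADAPTED / U-TRANSPORTED BD-strip cells of the `(U, n, t′)` grid) row as certified numbers with their
Lean instance pending. This file is the `t′`-twin of `Theorems/R2cStripCellEnergyDensity.lean` +
`R2cStripCellSectorEnergyDensity.lean` + `R2cStripCellSpinSectors.lean` §D, with the cell bond matrix
`hh = stripCellBondMatrixTT' κ hc t t' U` (`Upper/StripCellHamiltonianTTPrime.lean`; at `t′ = 0` it is `stripCellBondMatrix`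
on the nose) and the row-sum constant `γ₀(t,t′,U) = |t|·(4((c−1)W + c(W−1)) + 4W) + |t′|·(8(c−1)(W−1) + 8(W−1)) + |U|·cW`:

* **`energyDensityTT'_le_of_stripCell_umps_dual_TT'`** — THE ROW-MAKER (exactly isometric tensor):
  `e(t, t′, U, Q_c/(cW)) ≤ c_cert/(cW)`; proof = the GC all-`k` consumer `energyDensityTT'_le_of_gcFamily_right_anyBox t t'`
  with `μ = s` a supporting slope of the convex `x ↦ e(t, t′, U, x)` at `ρ = Q_c/(cW)` (`exists_supporting_line_energyDensityTT'`,
  Literature — both already `t′`-general), fed with `stripCell_family_fock_TT'`;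
* `energyDensityTT'_le_of_stripCell_umps_dual_dyadic_TT'` — STORED nearly isometric tensor via Lemma P;
* `energyDensityTT'_le_of_stripCell_umps_dual_dyadic_structural_sectors₂_TT'` — `hγ hX₁ hX₂` discharged at `γ₀(t,t′,U)`
  (`stripCellBondMatrixTT'_loewner`) and the dense dual hypothesis replaced by one PSD principal block per occurring
  `(lab↑, lab↓)` pair (`posSemidef_sub_dualMatrix_of_sectors₂`, `stripCellBondMatrixTT'_conservesSpinCharge`);
* **`energyDensityTT'_le_of_exists_stripCellCertTT'`** — CLAIM-NODE PACKAGING: the shape a `Certificates/…` node for a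
  `bd-strip-cell-v1` certificate at ANY `(t, t′, U ≥ 0)` takes, tensor data in ONE existential, scalar side goals for
  `norm_num`. At `t′ = 0` it is `…_of_exists_stripCellCert₂` with `hη` weakened by the (vanishing) `|t′|` term.

Sources: Ruelle (1969) §3.4 (convexity / supporting lines) [Ruelle1969]; Horn–Johnson (2013) Thm. 6.1.1, 7.3.1
[HornJohnson2013]; VAR `METHOD-umps.md` Thm U1; eng-1 `FORMAT-bdstrip-cell-v1.md` (the `(q↑, q↓)` blocks; term list with
exact `(t, t′, U)` incl. the diagonal bonds).
-/

noncomputable section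

open Matrix Finset
open scoped ComplexOrder BigOperators

namespace Summit.Ventures.CertifiedManyBodySolver.Theorems

open Literature.MathematicalPhysics.QuantumLattice
open Literature.MathematicalPhysics.QuantumLattice.JordanWigner
open Literature.MathematicalPhysics.QuantumLattice.ThermodynamicLimit
open Literature.LinearAlgebra.Matrix.PolarOrthonormalization
open Summit.Ventures.CertifiedManyBodySolver.Upper

variable {W c Q D : ℕ}

/-! ### Row-makers at `(t, t′, U)` -/

section RowMakers

/-- **ROW-MAKER: a `t–t′` strip-cell uMPS certificate bounds the 2-D thermodynamic-limit energy density at its own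
filling.** DATA (`U ≥ 0`, any `t, t′`): cell `c × W` (`c, W ≥ 1`), enumeration `κ`, an EXACTLY left-isometric cell tensor
`A`, unit boundary vector `r`, dual `Z`, reals `c_cert, z` with `c_cert·1 − W(A; stripCellBondMatrixTT' κ hc t t' U, Z) ⪰ 0`,
`z·1 ∓ Z ⪰ 0`; integer bond labels in `[qmin, qmax]` with the `U(1)` block rule and cell charge `0 < Q_c < 2cW`.
THEN `e(t, t′, U, Q_c/(cW)) ≤ c_cert/(cW)`. [cite: Ruelle1969, §3.4] -/
theorem energyDensityTT'_le_of_stripCell_umps_dual_TT' (W c : ℕ) (hW : 1 ≤ W) (hc : 0 < c)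
    (κ : TensorIndex (Fin c ×ₗ Fin W) 4 ≃ Fin Q) (A : MPSTensor Q D) (hA : ∑ S, (A S)ᴴ * A S = 1)
    (r : Fin D → ℂ) (hr : star r ⬝ᵥ r = 1) (Z : Matrix (Fin D) (Fin D) ℂ) (t t' : ℝ) {U : ℝ} (hU : 0 ≤ U)
    {cc z : ℝ}
    (hdual : (((cc : ℝ) : ℂ) • (1 : Matrix (Fin D) (Fin D) ℂ) -
      dualMatrix A (stripCellBondMatrixTT' κ hc t t' U) Z).PosSemidef)
    (hZ₁ : (((z : ℝ) : ℂ) • (1 : Matrix (Fin D) (Fin D) ℂ) - Z).PosSemidef)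
    (hZ₂ : (((z : ℝ) : ℂ) • (1 : Matrix (Fin D) (Fin D) ℂ) + Z).PosSemidef)
    (lab : Fin D → ℤ) (Qc qmin qmax : ℤ)
    (hBC : ∀ (S : Fin Q) (α β : Fin D), A S α β ≠ 0 →
      lab β + Qc = lab α + ((∑ f, siteCharge (κ.symm S f) : ℕ) : ℤ))
    (hlab : ∀ α, qmin ≤ lab α ∧ lab α ≤ qmax) (hQ0 : 0 < Qc) (hQ2 : Qc < 2 * ((c : ℤ) * (W : ℤ))) :
    energyDensityTT' t t' U (((Qc : ℤ) : ℝ) / ((c : ℝ) * (W : ℝ))) ≤ cc / ((c : ℝ) * (W : ℝ)) := by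
  have hcW : (0 : ℝ) < (c : ℝ) * (W : ℝ) := by
    have : (0 : ℕ) < c * W := Nat.mul_pos hc hW
    exact_mod_cast this
  set ρ : ℝ := ((Qc : ℤ) : ℝ) / ((c : ℝ) * (W : ℝ)) with hρ
  have hρ0 : 0 < ρ := div_pos (by exact_mod_cast hQ0) hcW
  have hρ2 : ρ < 2 := by
    rw [hρ, div_lt_iff₀ hcW]
    have : ((Qc : ℤ) : ℝ) < 2 * ((c : ℝ) * (W : ℝ)) := by exact_mod_cast hQ2
    linarith
  have hρcW : ρ * ((c : ℝ) * (W : ℝ)) = ((Qc : ℤ) : ℝ) := div_mul_cancel₀ _ hcW.ne'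
  -- the last-cell constant
  obtain ⟨K, hK₀⟩ := exists_nat_smul_one_sub_posSemidef (hubbardOpenBoxTT' c W t t' U)
    (hubbardOpenBoxTT'_isHermitian c W t t' U)
  have hK : ((((K : ℕ) : ℝ) : ℂ) • (1 : Matrix (Fin Q) (Fin Q) ℂ) -
      superSite κ (toSpin (hubbardOpenBoxTT' c W t t' U))).PosSemidef := by
    have h1 : superSite κ (toSpin ((((K : ℕ) : ℝ) : ℂ) •
        (1 : Matrix (Finset (Orb (Fin c ×ₗ Fin W))) (Finset (Orb (Fin c ×ₗ Fin W))) ℂ) -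
          hubbardOpenBoxTT' c W t t' U)) =
        (((K : ℕ) : ℝ) : ℂ) • (1 : Matrix (Fin Q) (Fin Q) ℂ) -
          superSite κ (toSpin (hubbardOpenBoxTT' c W t t' U)) := by
      rw [map_sub, map_smul, map_sub, map_smul, superSite_toSpin_one]
    rw [← h1, posSemidef_superSite_iff, posSemidef_toSpin_iff]
    exact hK₀
  -- a supporting slope of the convex energy density at `ρ`
  obtain ⟨s, hs⟩ := exists_supporting_line_energyDensityTT' t t' hU hρ0 hρ2
  set qd : ℝ := ((qmax : ℤ) : ℝ) - ((qmin : ℤ) : ℝ) with hqd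
  have hc1 : 1 ≤ c := hc
  refine energyDensityTT'_le_of_gcFamily_right_anyBox t t' hU s (cc / ((c : ℝ) * (W : ℝ))) le_rfl hs hc1 hW
    (E := 2 * |z| + K + |s| * qd - s * ((Qc : ℤ) : ℝ)) (Δ := cc - 2 * |z| - K - |s| * qd)
    (M := ((Qc : ℤ) : ℝ) - qd) (Γ := qd) ?_ ?_ ?_
  · -- `E + Δ = c_cert − s·Q_c = (c_cert/(cW) − s ρ)·(cW)`
    rw [sub_mul, div_mul_cancel₀ _ hcW.ne', mul_assoc, hρcW]
    linarith
  · rw [hρcW]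
    linarith
  · intro k hk
    obtain ⟨hS, hE, hNlo, hNhi⟩ :=
      stripCell_family_fock_TT' hc κ hA hr Z t t' hdual hZ₁ hZ₂ hK lab Qc hBC hlab k hk
    refine ⟨k * c, W, Nat.mul_pos hk hc, hW, by ring, D, fun l =>
      toSpinVec.symm (fun σ => mpsOpen k A (Pi.single l 1) r (superCfg (stripCells k c W) κ σ)), ?_, ?_, ?_⟩
    · rw [hS]; exact one_pos
    · rw [hS, mul_one]
      set N := ∑ l, (star (toSpinVec.symm (fun σ => mpsOpen k A (Pi.single l 1) r
        (superCfg (stripCells k c W) κ σ))) ⬝ᵥ (totalNumber *ᵥ toSpinVec.symm (fun σ =>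
          mpsOpen k A (Pi.single l 1) r (superCfg (stripCells k c W) κ σ)))).re with hNdef
      have hdev : |N - (k : ℝ) * ((Qc : ℤ) : ℝ)| ≤ qd := abs_sub_le_iff.2 ⟨by linarith, by linarith⟩
      have hsN : -(s * N) ≤ -(s * ((k : ℝ) * ((Qc : ℤ) : ℝ))) + |s| * qd := by
        have h1 : -(s * (N - (k : ℝ) * ((Qc : ℤ) : ℝ))) ≤ |s| * qd :=
          (neg_le_abs _).trans (by rw [abs_mul]; exact mul_le_mul_of_nonneg_left hdev (abs_nonneg s))
        linarith
      nlinarith [hE, hsN]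
    · rw [hS, mul_one]
      linarith

/-- **ROW-MAKER for STORED (nearly isometric) tensors at `(t, t′, U)`** (Lemma P): as
`energyDensityTT'_le_of_stripCell_umps_dual_TT'` with the stored tensor `A`, its Gram row-sum defect `ε < 1`, `γ·1 ∓ hh ⪰ 0`,
the slack `η ≥ (1 + 1/(1−ε))·(ε/(1−ε))·(1+ε)·(γ(1+(1+ε)) + z)` and the certified `(c_cert − η)·1 − W(A; hh, Z) ⪰ 0`.
[cite: Ruelle1969, §3.4] [cite: HornJohnson2013, Thm. 7.3.1] -/
theorem energyDensityTT'_le_of_stripCell_umps_dual_dyadic_TT' (W c : ℕ) (hW : 1 ≤ W) (hc : 0 < c)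
    (κ : TensorIndex (Fin c ×ₗ Fin W) 4 ≃ Fin Q) (A : MPSTensor Q D) (t t' : ℝ) {U : ℝ} (hU : 0 ≤ U)
    {ε γ η cc z : ℝ} (hε0 : 0 ≤ ε) (hε1 : ε < 1) (hγ : 0 ≤ γ) (hz : 0 ≤ z)
    (hG : ∀ i, ∑ j, ‖(Upper.gram A - 1) i j‖ ≤ ε)
    (hX₁ : ((γ : ℂ) • (1 : Matrix (Fin Q × Fin Q) (Fin Q × Fin Q) ℂ) -
      stripCellBondMatrixTT' κ hc t t' U).PosSemidef)
    (hX₂ : ((γ : ℂ) • (1 : Matrix (Fin Q × Fin Q) (Fin Q × Fin Q) ℂ) +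
      stripCellBondMatrixTT' κ hc t t' U).PosSemidef)
    (r : Fin D → ℂ) (hr : star r ⬝ᵥ r = 1) (Z : Matrix (Fin D) (Fin D) ℂ)
    (hZ₁ : (((z : ℝ) : ℂ) • (1 : Matrix (Fin D) (Fin D) ℂ) - Z).PosSemidef)
    (hZ₂ : (((z : ℝ) : ℂ) • (1 : Matrix (Fin D) (Fin D) ℂ) + Z).PosSemidef)
    (hη : (1 + 1 / (1 - ε)) * (ε / (1 - ε)) * (1 + ε) * (γ * (1 + (1 + ε)) + z) ≤ η)
    (hdual : (((cc - η : ℝ) : ℂ) • (1 : Matrix (Fin D) (Fin D) ℂ) -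
      dualMatrix A (stripCellBondMatrixTT' κ hc t t' U) Z).PosSemidef)
    (lab : Fin D → ℤ) (Qc qmin qmax : ℤ)
    (hBC : ∀ (S : Fin Q) (α β : Fin D), A S α β ≠ 0 →
      lab β + Qc = lab α + ((∑ f, siteCharge (κ.symm S f) : ℕ) : ℤ))
    (hlab : ∀ α, qmin ≤ lab α ∧ lab α ≤ qmax) (hQ0 : 0 < Qc) (hQ2 : Qc < 2 * ((c : ℤ) * (W : ℤ))) :
    energyDensityTT' t t' U (((Qc : ℤ) : ℝ) / ((c : ℝ) * (W : ℝ))) ≤ cc / ((c : ℝ) * (W : ℝ)) := by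
  obtain ⟨hiso, hdual'⟩ := polarTensor_dual_certificate hε0 hε1 hγ hz hG hX₁ hX₂ hZ₁ hZ₂ hη hdual
  exact energyDensityTT'_le_of_stripCell_umps_dual_TT' W c hW hc κ (polarTensor A) hiso r hr Z t t' hU hdual'
    hZ₁ hZ₂ lab Qc qmin qmax (polarTensor_charges _ lab Qc hBC) hlab hQ0 hQ2

/-- **Row-maker, STORED (dyadic) tensor, PER-`(n↑,n↓)`-SECTOR dual certificate, PRODUCER-FREE bond-matrix bound, at
`(t, t′, U)`.** `energyDensityTT'_le_of_stripCell_umps_dual_dyadic_TT'` with `hγ hX₁ hX₂` discharged at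
`γ₀ = |t|·(4((c−1)W + c(W−1)) + 4W) + |t′|·(8(c−1)(W−1) + 8(W−1)) + |U|·cW` and the dense dual hypothesis replaced by one
PSD principal block per occurring label PAIR `(lab↑ α, lab↓ α)`; spin-resolved block rules
(`A S α β ≠ 0 → lab_σ β + Q_σ = lab_σ α + cellSpinCharge κ σ S`), the window on the total label, `Q_c = Q↑ + Q↓`.
Conclusion `e(t, t′, U, Q_c/(cW)) ≤ c_cert/(cW)`. [cite: Ruelle1969, §3.4] [cite: HornJohnson2013, Thm. 6.1.1] -/
theorem energyDensityTT'_le_of_stripCell_umps_dual_dyadic_structural_sectors₂_TT' (W c : ℕ) (hW : 1 ≤ W)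
    (hc : 0 < c) (κ : TensorIndex (Fin c ×ₗ Fin W) 4 ≃ Fin Q) (A : MPSTensor Q D) (t t' : ℝ) {U : ℝ}
    (hU : 0 ≤ U) {ε η cc z : ℝ} (hε0 : 0 ≤ ε) (hε1 : ε < 1) (hz : 0 ≤ z)
    (hG : ∀ i, ∑ j, ‖(Upper.gram A - 1) i j‖ ≤ ε)
    (r : Fin D → ℂ) (hr : star r ⬝ᵥ r = 1) (Z : Matrix (Fin D) (Fin D) ℂ)
    (hZ₁ : (((z : ℝ) : ℂ) • (1 : Matrix (Fin D) (Fin D) ℂ) - Z).PosSemidef)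
    (hZ₂ : (((z : ℝ) : ℂ) • (1 : Matrix (Fin D) (Fin D) ℂ) + Z).PosSemidef)
    (hη : (1 + 1 / (1 - ε)) * (ε / (1 - ε)) * (1 + ε) *
      ((|t| * (4 * (((c - 1) * W + c * (W - 1) : ℕ) : ℝ) + 4 * W) +
        |t'| * (8 * (((c - 1) * (W - 1) : ℕ) : ℝ) + 8 * ((W - 1 : ℕ) : ℝ)) + |U| * (c * W)) *
          (1 + (1 + ε)) + z) ≤ η)
    (labU labD : Fin D → ℤ) (QU QD qmin qmax : ℤ)
    (hBCU : ∀ (S : Fin Q) (α β : Fin D), A S α β ≠ 0 → labU β + QU = labU α + cellSpinCharge κ 0 S)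
    (hBCD : ∀ (S : Fin Q) (α β : Fin D), A S α β ≠ 0 → labD β + QD = labD α + cellSpinCharge κ 1 S)
    (hlab : ∀ α, qmin ≤ labU α + labD α ∧ labU α + labD α ≤ qmax) (hQ0 : 0 < QU + QD)
    (hQ2 : QU + QD < 2 * ((c : ℤ) * (W : ℤ)))
    (hZb : ∀ α β, Z α β ≠ 0 → labU α = labU β ∧ labD α = labD β)
    {m : ℤ × ℤ → ℕ} (emb : ∀ q, Fin (m q) → Fin D) (hinj : ∀ q, Function.Injective (emb q))
    (hcover : ∀ α, ∃ i, emb (labU α, labD α) i = α)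
    (hpsd : ∀ q ∈ Finset.univ.image (fun α => (labU α, labD α)),
      (((((cc - η : ℝ) : ℂ)) • (1 : Matrix (Fin D) (Fin D) ℂ) -
          dualMatrix A (stripCellBondMatrixTT' κ hc t t' U) Z).submatrix (emb q) (emb q)).PosSemidef) :
    energyDensityTT' t t' U (((QU + QD : ℤ) : ℝ) / ((c : ℝ) * (W : ℝ))) ≤ cc / ((c : ℝ) * (W : ℝ)) := by
  have hγ : stripCellRowBoundTT' c W t t' U =
      |t| * (4 * (((c - 1) * W + c * (W - 1) : ℕ) : ℝ) + 4 * W) +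
        |t'| * (8 * (((c - 1) * (W - 1) : ℕ) : ℝ) + 8 * ((W - 1 : ℕ) : ℝ)) + |U| * (c * W) :=
    stripCellRowBoundTT'_eq c W t t' U
  have hγ0 : (0 : ℝ) ≤ |t| * (4 * (((c - 1) * W + c * (W - 1) : ℕ) : ℝ) + 4 * W) +
      |t'| * (8 * (((c - 1) * (W - 1) : ℕ) : ℝ) + 8 * ((W - 1 : ℕ) : ℝ)) + |U| * (c * W) := by positivity
  obtain ⟨hX₁, hX₂⟩ := stripCellBondMatrixTT'_loewner κ hc t t' U hγ.le
  have hBC : ∀ (S : Fin Q) (α β : Fin D), A S α β ≠ 0 →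
      (labU β + labD β) + (QU + QD) = (labU α + labD α) + cellCharge κ S := by
    intro S α β h
    have h1 := hBCU S α β h
    have h2 := hBCD S α β h
    rw [cellCharge_eq_cellSpinCharge_add]
    push_cast
    linarith
  have hWd := posSemidef_sub_dualMatrix_of_sectors₂ A labU labD QU QD (cellSpinCharge κ 0) (cellSpinCharge κ 1)
    hBCU hBCD (stripCellBondMatrixTT' κ hc t t' U) (stripCellBondMatrixTT'_conservesSpinCharge κ hc t t' U 0)
    (stripCellBondMatrixTT'_conservesSpinCharge κ hc t t' U 1) Z hZb _ emb hinj hcover hpsd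
  exact energyDensityTT'_le_of_stripCell_umps_dual_dyadic_TT' W c hW hc κ A t t' hU hε0 hε1 hγ0 hz hG hX₁ hX₂ r hr Z
    hZ₁ hZ₂ hη hWd (fun α => labU α + labD α) (QU + QD) qmin qmax hBC hlab hQ0 hQ2

/-- **CLAIM-NODE PACKAGING at `(t, t′, U)`, two-charge sectors (energy-density row).** The shape a `Certificates/…` claim
node for a `bd-strip-cell-v1` certificate of a `t–t′` strip cell takes, with the verifier's `(q↑, q↓)` blocks VERBATIM:
tensor data `A, r, Z, lab↑, lab↓, m, emb` in ONE existential proposition, the scalar side conditions outside as `norm_num`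
goals; the cell bond matrix is `stripCellBondMatrixTT' κ hc t t' U` (intra-cell horizontal + diagonal bonds + on-site term
of the LEFT cell, horizontal + `2(W−1)` diagonal inter-cell bonds). Conclusion `e(t, t′, U, (Q↑+Q↓)/(cW)) ≤ c_cert/(cW)`.
HONEST FRAMING: nothing here asserts that such a certificate exists. [cite: Ruelle1969, §3.4] -/
theorem energyDensityTT'_le_of_exists_stripCellCertTT' (W c : ℕ) (hW : 1 ≤ W) (hc : 0 < c)
    (κ : TensorIndex (Fin c ×ₗ Fin W) 4 ≃ Fin Q) (D : ℕ) (t t' : ℝ) {U : ℝ} (hU : 0 ≤ U) (ε η cc z : ℝ)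
    (QU QD qmin qmax : ℤ) (hε0 : 0 ≤ ε) (hε1 : ε < 1) (hz : 0 ≤ z)
    (hη : (1 + 1 / (1 - ε)) * (ε / (1 - ε)) * (1 + ε) *
      ((|t| * (4 * (((c - 1) * W + c * (W - 1) : ℕ) : ℝ) + 4 * W) +
        |t'| * (8 * (((c - 1) * (W - 1) : ℕ) : ℝ) + 8 * ((W - 1 : ℕ) : ℝ)) + |U| * (c * W)) *
          (1 + (1 + ε)) + z) ≤ η)
    (hQ0 : 0 < QU + QD) (hQ2 : QU + QD < 2 * ((c : ℤ) * (W : ℤ)))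
    (hex : ∃ (A : MPSTensor Q D) (r : Fin D → ℂ) (Z : Matrix (Fin D) (Fin D) ℂ) (labU labD : Fin D → ℤ)
        (m : ℤ × ℤ → ℕ) (emb : ∀ q, Fin (m q) → Fin D),
        (∀ i, ∑ j, ‖(Upper.gram A - 1) i j‖ ≤ ε) ∧ star r ⬝ᵥ r = 1 ∧
        ((((z : ℝ) : ℂ)) • (1 : Matrix (Fin D) (Fin D) ℂ) - Z).PosSemidef ∧
        ((((z : ℝ) : ℂ)) • (1 : Matrix (Fin D) (Fin D) ℂ) + Z).PosSemidef ∧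
        (∀ (S : Fin Q) (α β : Fin D), A S α β ≠ 0 → labU β + QU = labU α + cellSpinCharge κ 0 S) ∧
        (∀ (S : Fin Q) (α β : Fin D), A S α β ≠ 0 → labD β + QD = labD α + cellSpinCharge κ 1 S) ∧
        (∀ α, qmin ≤ labU α + labD α ∧ labU α + labD α ≤ qmax) ∧
        (∀ α β, Z α β ≠ 0 → labU α = labU β ∧ labD α = labD β) ∧
        (∀ q, Function.Injective (emb q)) ∧ (∀ α, ∃ i, emb (labU α, labD α) i = α) ∧
        (∀ q ∈ Finset.univ.image (fun α => (labU α, labD α)),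
          (((((cc - η : ℝ) : ℂ)) • (1 : Matrix (Fin D) (Fin D) ℂ) -
              dualMatrix A (stripCellBondMatrixTT' κ hc t t' U) Z).submatrix (emb q) (emb q)).PosSemidef)) :
    energyDensityTT' t t' U (((QU + QD : ℤ) : ℝ) / ((c : ℝ) * (W : ℝ))) ≤ cc / ((c : ℝ) * (W : ℝ)) := by
  obtain ⟨A, r, Z, labU, labD, m, emb, hG, hr, hZ₁, hZ₂, hBCU, hBCD, hlab, hZb, hinj, hcover, hpsd⟩ := hex
  exact energyDensityTT'_le_of_stripCell_umps_dual_dyadic_structural_sectors₂_TT' W c hW hc κ A t t' hU hε0 hε1 hz hG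
    r hr Z hZ₁ hZ₂ hη labU labD QU QD qmin qmax hBCU hBCD hlab hQ0 hQ2 hZb emb hinj hcover hpsd

end RowMakers

end Summit.Ventures.CertifiedManyBodySolver.Theorems

end
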